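import Summits.HodgeConjecture.HodgeConjecture.Theorems.Ring2AbelianAllAndreJunction
import Summits.HodgeConjecture.HodgeConjecture.Theorems.EndoscopicMiddleDegreeCupProductAlgebraic
import Literature.AlgebraicGeometry.HodgeTheory.MotivatedClassesProofs
import Literature.AlgebraicGeometry.HodgeTheory.SupportedHodgeClassDescent
import Literature.AlgebraicGeometry.HodgeTheory.ComplexOrientationFamily
import Literature.AlgebraicTopology.SingularHomology.GysinMapSupportProofs
import HarnessLib

/-!
# Ring 2 · sub-cell AbelianAll (ALL ABELIAN VARIETIES), André axis, part V — `B_min` WEAKENED from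
# conjecture `B` for the total space to ONE Lefschetz-type operator: the FIBRE-CLASS (β-) LEFSCHETZ node
# (an algebraic correspondence inverting "cup with the fibre class" on fibre restrictions), its transport
# consequences PROVED IN THE KERNEL with no named fact (part VI, `Ring2AbelianAllAndreLiftOnPath`: the
# on-path of the lift nodes (L), (L∀))

HONEST FRAMING (page 1, verbatim): **research route, not a corollary; conditional on HC_CM plus one named
minimal statement.** Cell line: research route conditional on HC_CM; not a corollary; Q11.4-sentence-2
already refuted in dim ≥ 3. Nothing in this file proves a case of the Hodge conjecture. `HC_CM` =
`Theses.RankFourFaces.CMAbelianHodge` (a BINDER, never cited, never an axiom), `HC_AV` =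
`Theses.PadicSemiregularLift.HodgeAbelianVarieties`, the reduction item `Theses.RankFourFaces.CMToAbelian`
(stmt-16267) is OPEN and not closed here. Seat `pub-hodge-ring2-ab-andre-2`, gen 2; brief (ii) "replace `B` by
algebraicity of specific Künneth/Lefschetz components and re-prove" and (iii) "identify precisely why Lieberman
does not suffice … partial results as theorems"; owed item o2 (type Abdulali's Conjecture 5.3 = the base half of
`B(𝒳)`) of RING2-MAP §AbelianAll AA2.4/AA2.5 (o3, the on-path of (L)/(L∀), is part VI).
**ERRATUM (gen 2, RING2-MAP AA2.13; referee F-ab-32, docstring-only revision gen 4): the §A nodes `FibreClassLefschetzFor` (unbounded `∀ p`: `IsAlgebraicCorrespondence (d+1) (d+1) 𝒳 𝒳 T` has no degree solution for `p ≥ d+2`), (β∀) `FibreClassLefschetzCompactPencils`, (β) `FibreClassLefschetzCMPointedPencils`, (β∃) `CMAnchoredPencilFibreClassLefschetz` are REFUTED-MISSTATED — FALSE AS TYPED (`not_fibreClassLefschetzFor`, part VIII `Ring2AbelianAllAndreFibreClassRange`) — so every §B/§C row taking one of them as a hypothesis is VACUOUS;**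
**SUPERSEDED by part VIII's repaired nodes with the degree bound `p ≤ d`: `FibreClassLefschetzOn hf` (β′_f), `FibreClassLefschetzOnCompactPencils` (β∀′), `FibreClassLefschetzOnCMPointedPencils` (β′), `CMAnchoredPencilFibreClassLefschetzOn` (β∃′), `FibreClassLefschetzOnAtRelDim d`, where EVERY edge and row of this part is re-proved (e.g. `HC_AV_of_HC_CM_and_fibreClassLefschetzOnCMPointedPencils`, `HC_AV_of_HC_CM_and_cmAnchoredPencilFibreClassLefschetzOn`, `fibreClassOn_chain`).**
The §0 toolkit (`fiberGysin`, projection formula, algebraicity lemmas) is unaffected and in use; the refuted declarations are kept verbatim for the record (def bodies are append-only) — read each "(β…)" below as a pointer to part VIII's "(β…′)".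

## What parts I–IV left open, and what this part does

Parts I–IV typed the transport candidates (2) ⊒ (3) ⊒ (4), the lift nodes (L∀) ⊒ (L), and the Lefschetz
candidates (5∀) ⊒ (5) = `StandardConjectureBStar` (ALL of `B` in André's `*_L`-form) for the `(d+1)`-dimensional
total space `𝒳` of a compact pencil `f : 𝒳 ⟶ S` of abelian `d`-folds; the edge "(5) ⟹ (3)" was kernel only
MODULO the named fact `h₈ = Abdulali1994_invariantCycles_of_lefschetzStandard` (Abdulali 1994 p. 1122 / Milne 2020
Prop. 1), whose printed proof uses of `B(𝒳)` exactly one thing (RING2-MAP AA2.5): an algebraic inverse of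
`∪[F] : H⁰(S, R^{2p}f_*ℚ) ⥲ H²(S, R^{2p}f_*ℚ)` (`[F] = [𝒳_t]` the fibre class; invariants → co-invariants of
monodromy), i.e. Abdulali's CONJECTURE 5.3 [Abdulali1994FamiliesAV, p. 1130]: "`* : AH^{(0,2r)}_{(2)}(A,ℂ) →
AH^{(2d,2m−2r)}_{(2)}(A,ℂ)` … CONJECTURE 5.3. The map (5.2) is an isomorphism. REMARK 5.4 … for compact A,
Conjecture 5.3 is a special case of Grothendieck's standard conjectures … THEOREM 5.5. If Conjecture 5.3 is true
then `φ_P : AH^{(0,2r)}(A,ℂ) → AH^{2r}(A_P,ℂ)^Γ` is an isomorphism for every P" — the algebraic théorème de la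
partie fixe, our (L∀). This part TYPES that one operator on the tree's real carriers WITHOUT the Leray pieces /
`θ_n`-weights (no abelian-scheme carrier needed, AA2.7 o2): since `j_{t*} j_t^* W = W ∪ [𝒳_t]` (projection
formula) and `ker j_s^* = L¹H^{2p}(𝒳) = ker(∪[𝒳_t])`, "an algebraic correspondence `T` of `𝒳` inverts `∪[F]` on
`H⁰(S, R^{2p})`" reads `j_s^*(T(j_{t*} j_t^* W)) = j_s^* W` for all global `W` and all `s, t` — `j_t = fiberι f t`,
`j_{t*}` the tree's CONSTRUCTED Gysin morphism `complexGysin` (complex orientations), "algebraic correspondence"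
the tree's `IsAlgebraicCorrespondence` (André §2.1 / Voisin II (10.7) on the real carriers).

## Content

* §0 TOOLKIT (theorems, no hypothesis of the cell): algebraic correspondences map algebraic classes to
  algebraic classes (`map_mem_algebraicClasses_of_isAlgebraicCorrespondence`: the tree's reduction
  `corrClassAction_mem_algebraicClasses_of_cupProduct` fed with the PROVED multiplicativity
  `Theorems.Voisin2003_cupProduct_algebraicClasses_holds`); the fibre Gysin map `fiberGysin hf t p = j_{t*}`
  and `j_{t*}` preserves algebraic classes (`complexGysin_mem_algebraicClasses` with the proved support
  property `gysinMap_restrictCompl_eq_zero_of_field ℂ`); `j_{t*} j_t^* W = W ∪ j_{t*} 1` (projection formula) and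
  the fibre class `j_{t*} 1` is algebraic — so `∪[𝒳_t]` is itself an algebraic correspondence of `𝒳`.
* §A NODES (OPEN; hypotheses wherever used): `FibreClassLefschetzFor hf` — β-Lefschetz for ONE compact pencil
  (in every degree `p` some algebraic `T : H^{2p+2}(𝒳) → H^{2p}(𝒳)` with `j_s^* T j_{t*} j_t^* = j_s^*` for all
  `s, t`); (β∀) `FibreClassLefschetzCompactPencils` (every compact pencil of abelian varieties); (β)
  `FibreClassLefschetzCMPointedPencils` (those with a CM fibre); (β∃) `CMAnchoredPencilFibreClassLefschetz` (per
  Hodge class, SOME CM-anchored pencil of Lemme 6.3.1 satisfying it).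
* §B KERNEL EDGES, NO NAMED FACT: (β∀) ⟹ (L∀); (β) ⟹ (L); (β) ⟹ (3); (β∀) ⟹ (2); (β) ⟹ (4); (β∃) ⟹ (T∃);
  (β) ∧ Lemme 6.3.1 ⟹ (β∃). The engine: `η := T(j_{s₀*} j_{s₀}^* W)` is a global ALGEBRAIC class agreeing with
  `W` on EVERY fibre as soon as `W|_{𝒳_{s₀}}` is algebraic (`exists_algebraic_lift_of_fibreClassLefschetzFor`).
* §C ROWS: `HC_CM ∧ (β) ⟹ HC_AV` K[6.3.1] (`HC_AV_of_HC_CM_and_fibreClassLefschetzCMPointedPencils` — the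
  Lefschetz-flavoured deliverable with the Abdulali/Milne fact `h₈` of parts II–III ELIMINATED);
  `HC_CM ∧ (β∃) ⟹ HC_AV` K with NO named fact; KIND-1 witnesses `(β∀) ⟹ HC_CM` K[J] and `(β∀) ⟹ HC_AV`
  K[6.3.1, J]; Frame rows `ClosesWithCM (β)`, `ClosesWithCM (β∃)`, `CMIdle (β∀)`, `(β) ⟹ CMToAbelian` K[6.3.1].
* NOT claimed: `HodgeConjecture ⟹ (β)` (needs "a Hodge-structure morphism `H(𝒳) → H(𝒳)` is a Hodge class on
  `𝒳 × 𝒳`", Künneth/Poincaré on the real carriers — not in the tree; print: Voisin I Lemma 11.41), `HC_AV ⟹ (β)`,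
  `HC_AV ⟹ (L)` (both ask cycles on the non-abelian `𝒳 × 𝒳`, resp. `𝒳`), `(5) ⟹ (β)` (print only, next §); the
  on-path `HodgeConjecture ⟹ (L∀) ⟹ (L)` IS proved, in part VI.

## Print pedigree of (β), and the honest KIND column

(β) for one pencil is IMPLIED IN PRINT by Grothendieck's `B` for the base pieces `𝒳 × 𝒳 × Y`: André's
category of motifs modelled on motivated correspondences is semisimple UNCONDITIONALLY [Andre1996Motifs, Thm. 0.4
(p. 8); Prop. 3.3 (p. 21): "La ℚ-algèbre `C⁰_mot(X, X)` est semi-simple de dimension finie"], so the morphism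
`∪[F] : h(𝒳) → h(𝒳)(1)` has a MOTIVATED pseudo-inverse `T` (`(∪[F]) T (∪[F]) = ∪[F]`), which inverts `∪[F]` on
`H⁰(S, R^{2p})` because `ker(∪[F]|H^{2p}) = L¹ = ker j_s^*` (Leray for the smooth projective `f` over a curve and
Deligne's semisimplicity [DeligneHodgeII1971, 4.1.1]); under `B` motivated correspondences are algebraic
[Andre1996Motifs, §2.1 remark after Déf. 1 (p. 14), §0.3]. From `B(𝒳)` ALONE: `B` is stable under products
[Kleiman1968AlgebraicCycles, §2] [Murre2004LecturesMotives, §4.2.1.2 Rem. 2(a)], `B + Hdg ⟹ D` (hom = num)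
[Kleiman1994, Prop. 5.1, as reported in Murre's Torino lectures, Green–Murre–Voisin 1994 p. 123] and
`A_num(𝒳 × 𝒳)` is semisimple [Jannsen1992, Thm. 1], giving an ALGEBRAIC pseudo-inverse. INFERENCE (this seat,
5 lines, labelled): these are print theorems assembled by us; the edge `(5) ⟹ (β)` is therefore recorded
PRINT-ONLY (P) in RING2-MAP, not typed. So in PRINT `(5∀) ⟹ (β∀)`, `(5) ⟹ (β)`, and (β) holds MOTIVICALLY
(with `T` motivated) for every compact pencil — the open content of (β) is the algebraicity of ONE motivated
correspondence of `𝒳`. KIND (print), as in parts I–III: (β∀) is KIND 1 in the KERNEL too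
(`HC_CM_of_andre1996_of_fibreClassLefschetzCompactPencils`, via (L∀) ⟹ (2) and Lemmes 6.3.2–6.3.3); (β) is KIND 1
IN PRINT (Lemme 6.3.3's anchor `Eᴺ` may be taken CM, deform D.58) and `HC_CM`-LOAD-BEARING IN THE KERNEL; (β∃) is
KIND 2 (its pencils carry no anchor but a CM fibre), like (T∃)/CPS_∃. Why Lieberman does not help (brief
(iii)): `B` of the abelian FIBRES is used nowhere below; (β) is a statement about the `(d+1)`-fold `𝒳` and the
`(2d+2)`-fold `𝒳 × 𝒳` carrying `T`, neither of which is an abelian variety.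

References: Abdulali1994FamiliesAV ((5.1)–(5.2), Conj. 5.3, Rem. 5.4, Thm. 5.5, p. 1130; Lemma 6.2); Andre1996Motifs
(Thm. 0.4, §2.1, Prop. 3.3, §5.1, Lemme 6.3.1, Remarque 2); Milne2020HodgeClassesAV (Prop. 1); Kleiman1968AlgebraicCycles
(§2); Kleiman1994 (Prop. 5.1); Jannsen1992 (Thm. 1); Murre2004LecturesMotives (§4.2.1.2); DeligneHodgeII1971 (4.1.1);
VoisinHodgeI2002 (§7.3.2, Lemma 11.41); VoisinHodgeII2003 (Prop. 9.20–9.21, (10.7)); FultonYoungTableaux1997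
(App. B (5)–(6)); Fulton1998 (§19.1–19.2); Voisin2025 (§4.1); Hatcher2002 (§3.2).
-/

noncomputable section

set_option linter.dupNamespace false

namespace Summit.HodgeConjecture.HodgeConjecture.Ring2.AbelianAll

open CategoryTheory AlgebraicGeometry MonoidalCategory
open Literature.AlgebraicGeometry Literature.AlgebraicGeometry.Motives
open Literature.AlgebraicGeometry.HodgeTheory
open Literature.AlgebraicTopology.SingularHomology (singularCohomology cupProduct cupProduct_one
  gysinMap_restrictCompl_eq_zero_of_field)
open Literature.AlgebraicGeometry.Milne1999 (IsOfCMType)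
open Literature.AlgebraicGeometry.Abdulali1994 (InvariantCyclesHoldFor)
open Literature.AlgebraicGeometry.Andre1996 (andre1996_cmAnchoredPencil
  andre1996_cmHodgeClasses_algebraicallyAnchoredPencils IsCMAnchoredPencilFor)
open Literature.AlgebraicGeometry.Deligne1982 (cmLocus)
open Summit.HodgeConjecture.HodgeConjecture
open Summit.HodgeConjecture.HodgeConjecture.Theses
open Summit.HodgeConjecture.HodgeConjecture.Ring2.Deform (CompactAbelianPencilVHC
  HC_AV_of_andre1996_of_compactAbelianPencilVHC HC_CM_of_HC_AV HC_AV_of_hodgeConjecture)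

variable {𝒳 S : SchemeOver ℂ}

/-! ## §0 Toolkit: correspondences and Gysin maps preserve algebraic classes; the Hodge lift -/

/-- **An algebraic correspondence maps algebraic classes to algebraic classes** (Voisin II, Prop. 9.21
with (10.7): `cl(Γ_*(Z)) = [Γ]_*(cl Z)`; Fulton §19.2): for `T : H²ᵖ(X(ℂ)) → H^{2q}(W(ℂ))` induced by an
algebraic class on `W × X` (`IsAlgebraicCorrespondence m n W X T`, `W`, `X` smooth projective of dimensions `m`,
`n`), `T(Nᵖ H²ᵖ(X)) ⊆ N^q H^{2q}(W)`. The tree's reduction `corrClassAction_mem_algebraicClasses_of_cupProduct`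
(flat pull-back, cup product, Gysin push-forward) fed with the PROVED multiplicativity of algebraic classes
`Theorems.Voisin2003_cupProduct_algebraicClasses_holds` on `W ⊗ X`. No hypothesis.
[cite: VoisinHodgeII2003, §9.2.4 Prop. 9.20–9.21 and (10.7)] [cite: Fulton1998, §19.2 Cor. 19.2 and §16.1] -/
theorem map_mem_algebraicClasses_of_isAlgebraicCorrespondence {m n : ℕ} {W X : SchemeOver ℂ}
    (hW : IsSmoothProjective m W) (hX : IsSmoothProjective n X) {p q : ℕ}
    {T : complexBetti X (2 * p) →ₗ[ℂ] complexBetti W (2 * q)} (hT : IsAlgebraicCorrespondence m n W X T)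
    {c : complexBetti X (2 * p)} (hc : c ∈ algebraicClasses X p) : T c ∈ algebraicClasses W q := by
  obtain ⟨μ, ν, -, hν, e, k, hab, hq, γ, hγ, rfl⟩ := hT
  exact corrClassAction_mem_algebraicClasses_of_cupProduct hW hX μ ν hν hab hq
    (fun x y hx hy ↦ Theorems.Voisin2003_cupProduct_algebraicClasses_holds
      (IsSmoothProjective.tensor_holds hW hX) hx hy) hγ hc

/-- **The Gysin morphism `j_{t*} : H²ᵖ(𝒳_t(ℂ); ℂ) → H^{2p+2}(𝒳(ℂ); ℂ)` of the inclusion `j_t : 𝒳_t ↪ 𝒳` of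
the fibre at `t` of a compact pencil of abelian varieties of relative dimension `d`** (the fibre is a smooth
projective `d`-fold, the total space a smooth projective `(d+1)`-fold): the tree's CONSTRUCTED Gysin morphism
`complexGysin` (`D_𝒳⁻¹ ∘ j_t(ℂ)_* ∘ D_{𝒳_t}`) for the complex orientation family `complexOrientationFamily`.
By the projection formula `j_{t*}(j_t^* W) = W ∪ j_{t*} 1 = W ∪ [𝒳_t]` — cup product with the FIBRE CLASS.
[cite: FultonYoungTableaux1997, Appendix B §B.1 (5)–(6)] [cite: VoisinHodgeI2002, §7.3.2] -/
def fiberGysin {d : ℕ} {f : 𝒳 ⟶ S} (hf : IsCompactAbelianPencil f d) (t : ComplexPoints S) (p : ℕ) :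
    complexBetti (fiberOver f t) (2 * p) →ₗ[ℂ] complexBetti 𝒳 (2 * (p + 1)) :=
  complexGysin complexOrientationFamily (hf.isSmoothProjective_fiberOver t) hf.isSmoothProjective_total
    (fiberι f t) (by omega)

/-- **`j_{t*}` maps algebraic classes of the fibre to algebraic classes of the total space** (push-forward
of cycles along the closed immersion `𝒳_t ↪ 𝒳`: `Nᵖ H²ᵖ(𝒳_t) → N^{p+1} H^{2p+2}(𝒳)`), by the tree's theorem
`complexGysin_mem_algebraicClasses` (support property of Gysin maps, `gysinMap_restrictCompl_eq_zero_of_field ℂ`,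
and Poincaré duality for the complex orientations, `hasPoincareDuality_complexOrientationFamily`).
[cite: Voisin2025, §4.1 Example 4.2 (p. 38)] [cite: Fulton1998, §19.1 and §1.4] -/
theorem fiberGysin_mem_algebraicClasses {d : ℕ} {f : 𝒳 ⟶ S} (hf : IsCompactAbelianPencil f d)
    (t : ComplexPoints S) {p : ℕ} {z : complexBetti (fiberOver f t) (2 * p)}
    (hz : z ∈ algebraicClasses (fiberOver f t) p) : fiberGysin hf t p z ∈ algebraicClasses 𝒳 (p + 1) :=
  complexGysin_mem_algebraicClasses (gysinMap_restrictCompl_eq_zero_of_field ℂ) complexOrientationFamily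
    hasPoincareDuality_complexOrientationFamily (hf.isSmoothProjective_fiberOver t) hf.isSmoothProjective_total
    (fiberι f t) (by omega) _ hz

/-- **`j_{t*} j_t^* W = W ∪ [𝒳_t]`: the operator inverted by β-Lefschetz IS cup product with the fibre class**
`[𝒳_t] := j_{t*} 1 ∈ H²(𝒳(ℂ); ℂ)` (projection formula `f_*(f^* x ∪ y) = x ∪ f_* y` with `y = 1`, the tree's
`complexGysin_cup`, and `a ∪ 1 = a`). Faithfulness of the name of the node; not used by the edges below.
[cite: FultonYoungTableaux1997, Appendix B §B.1 (6)] [cite: VoisinHodgeI2002, §7.3.2] -/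
theorem fiberGysin_map_fiberι_eq_cupProduct {d : ℕ} {f : 𝒳 ⟶ S} (hf : IsCompactAbelianPencil f d)
    (t : ComplexPoints S) {p : ℕ} (W : complexBetti 𝒳 (2 * p)) :
    fiberGysin hf t p (complexBetti.map (fiberι f t) (2 * p) W) =
      cupProduct (show 2 * p + 2 * (0 + 1) = 2 * (p + 1) by ring) W
        (fiberGysin hf t 0 (singularCohomology.one ℂ (ComplexPoints (fiberOver f t)))) := by
  have h := complexGysin_cup (μ := complexOrientationFamily) hasPoincareDuality_complexOrientationFamily
    (hf.isSmoothProjective_fiberOver t) hf.isSmoothProjective_total (fiberι f t) (Nat.add_zero (2 * p))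
    (show 2 * p + 2 * (d + 1) = 2 * (p + 1) + 2 * d by ring)
    (show 2 * 0 + 2 * (d + 1) = 2 * (0 + 1) + 2 * d by ring)
    (show 2 * p + 2 * (0 + 1) = 2 * (p + 1) by ring) W (singularCohomology.one ℂ (ComplexPoints (fiberOver f t)))
  rw [cupProduct_one] at h
  exact h

/-- **The fibre class `[𝒳_t] = j_{t*} 1` is algebraic** (`N¹ H²(𝒳)`: the class of the divisor `𝒳_t ⊂ 𝒳`), since
`1 ∈ N⁰ H⁰(𝒳_t) = H⁰` (`algebraicClasses_zero`) and `j_{t*}` preserves algebraic classes. So `W ↦ W ∪ [𝒳_t]` is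
itself an algebraic correspondence of `𝒳`; (β) asks for an algebraic correspondence inverse to it on fibre
restrictions. [cite: Fulton1998, §19.1] [cite: Voisin2025, §4.1 Example 4.2 (p. 38)] -/
theorem fiberGysin_one_mem_algebraicClasses {d : ℕ} {f : 𝒳 ⟶ S} (hf : IsCompactAbelianPencil f d)
    (t : ComplexPoints S) :
    fiberGysin hf t 0 (singularCohomology.one ℂ (ComplexPoints (fiberOver f t))) ∈ algebraicClasses 𝒳 (0 + 1) :=
  fiberGysin_mem_algebraicClasses hf t (by rw [algebraicClasses_zero]; exact Submodule.mem_top)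

/-! ## §A The fibre-class (β-) Lefschetz nodes -/

/-- **β-Lefschetz for ONE compact pencil `f : 𝒳 ⟶ S` of abelian varieties of relative dimension `d`**
(`hf : IsCompactAbelianPencil f d`) — the typed rendering of Abdulali's Conjecture 5.3 / the BASE half of
`B(𝒳)` (RING2-MAP AA2.5): in every degree `p` there is a linear map `T : H^{2p+2}(𝒳(ℂ); ℂ) → H²ᵖ(𝒳(ℂ); ℂ)`
INDUCED BY AN ALGEBRAIC CLASS ON `𝒳 × 𝒳` (`IsAlgebraicCorrespondence (d+1) (d+1) 𝒳 𝒳 T`) which inverts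
"cup with the fibre class" on fibre restrictions: `j_s^*(T(j_{t*} j_t^* W)) = j_s^* W` for every global class
`W` and all complex points `s, t` of the base (`j_t^* = complexBetti.map (fiberι f t)`, `j_{t*} = fiberGysin`).
Since `j_{t*} j_t^* = ∪[𝒳_t]` kills `L¹H^{2p} = ker j_s^*` and induces the isomorphism "invariants →
co-invariants" `H⁰(S, R^{2p}f_*ℂ) ⥲ H²(S, R^{2p}f_*ℂ)`, this says: the inverse of that isomorphism is given by
an algebraic correspondence — print's "`* : AH^{(0,2r)} → AH^{(2,2m−2r)}` is an isomorphism" (Conj. 5.3, with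
the relative Lefschetz isomorphism, a theorem, factored off). OPEN for `d ≥ 4`-ish total spaces; implied IN
PRINT by `B(𝒳)` (module docstring: product stability, `B + Hdg ⟹ D`, Jannsen; or André's motivated
semisimplicity + `B`); holds unconditionally with `T` MOTIVATED. A HYPOTHESIS wherever used.
**ERRATUM: REFUTED-MISSTATED (unbounded `p`; for `p ≥ d+2` no `T` is an `IsAlgebraicCorrespondence (d+1) (d+1)`, so this `Prop` is FALSE for every pencil: `not_fibreClassLefschetzFor`, part VIII `Ring2AbelianAllAndreFibreClassRange`); SUPERSEDED by `FibreClassLefschetzOn hf` (`p ≤ d`) of part VIII. Kept for the record.**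
[cite: Abdulali1994FamiliesAV, (5.1)–(5.2), Conjecture 5.3 and Theorem 5.5 (p. 1130)]
[cite: Andre1996Motifs, Thm. 0.4 (p. 8), §2.1 (p. 14) and Prop. 3.3 (p. 21)] -/
@[conjecture] def FibreClassLefschetzFor {d : ℕ} {f : 𝒳 ⟶ S} (hf : IsCompactAbelianPencil f d) : Prop :=
  ∀ p : ℕ, ∃ T : complexBetti 𝒳 (2 * (p + 1)) →ₗ[ℂ] complexBetti 𝒳 (2 * p),
    IsAlgebraicCorrespondence (d + 1) (d + 1) 𝒳 𝒳 T ∧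
      ∀ (W : complexBetti 𝒳 (2 * p)) (t s : ComplexPoints S),
        complexBetti.map (fiberι f s) (2 * p) (T (fiberGysin hf t p (complexBetti.map (fiberι f t) (2 * p) W))) =
          complexBetti.map (fiberι f s) (2 * p) W

/-- **(β∀) `FibreClassLefschetzCompactPencils` — β-Lefschetz for EVERY compact pencil of abelian varieties**
(the base half of André's Remarque 2 target "l'involution de Lefschetz … sur les pinceaux compacts de variétés
abéliennes est donnée par une correspondance algébrique"; weaker-or-equal IN PRINT than (5∀)
`LefschetzBCompactPencils`, the kernel comparison is not available). OPEN; a HYPOTHESIS wherever used; KIND 1 in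
the kernel (`HC_CM_of_andre1996_of_fibreClassLefschetzCompactPencils`). **ERRATUM: REFUTED-MISSTATED (unbounded `p` in `FibreClassLefschetzFor`; false given one compact pencil, `not_fibreClassLefschetzCompactPencils_of_pencil`, part VIII); SUPERSEDED by `FibreClassLefschetzOnCompactPencils` (β∀′) of part VIII. Kept for the record.**
[cite: Andre1996Motifs, Remarque 2 (p. 33)] [cite: Abdulali1994FamiliesAV, Conjecture 5.3 (p. 1130)] -/
@[conjecture] def FibreClassLefschetzCompactPencils : Prop :=
  ∀ ⦃d : ℕ⦄ ⦃𝒳 S : SchemeOver ℂ⦄ ⦃f : 𝒳 ⟶ S⦄ (hf : IsCompactAbelianPencil f d), FibreClassLefschetzFor hf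

/-- **(β) `FibreClassLefschetzCMPointedPencils` — β-Lefschetz for the compact pencils of abelian varieties
HAVING A CM FIBRE** (`(cmLocus f d).Nonempty`): the Lefschetz-type `B_min` of this part. With `HC_CM` and
Lemme 6.3.1 it gives `HC_AV` (`HC_AV_of_HC_CM_and_fibreClassLefschetzCMPointedPencils`) with NO further named
fact. OPEN; a HYPOTHESIS wherever used; KIND 1 in print, `HC_CM`-load-bearing in the kernel (module docstring). **ERRATUM: REFUTED-MISSTATED (unbounded `p` in `FibreClassLefschetzFor`; false given one CM-pointed compact pencil, `not_fibreClassLefschetzFor`, part VIII); SUPERSEDED by `FibreClassLefschetzOnCMPointedPencils` (β′) of part VIII, whose row `HC_AV_of_HC_CM_and_fibreClassLefschetzOnCMPointedPencils` replaces the vacuous one below. Kept for the record.**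
[cite: Andre1996Motifs, Lemme 6.3.1 (p. 31) and Remarque 2 (p. 33)] [cite: Abdulali1994FamiliesAV, Conjecture 5.3 and Main Theorem 6.1 (b) (pp. 1130–1131)] -/
@[conjecture] def FibreClassLefschetzCMPointedPencils : Prop :=
  ∀ ⦃d : ℕ⦄ ⦃𝒳 S : SchemeOver ℂ⦄ ⦃f : 𝒳 ⟶ S⦄ (hf : IsCompactAbelianPencil f d), (cmLocus f d).Nonempty →
    FibreClassLefschetzFor hf

/-- **(β∃) `CMAnchoredPencilFibreClassLefschetz` — per Hodge class, SOME CM-anchored compact pencil of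
Lemme 6.3.1 satisfies β-Lefschetz**: for every complex abelian variety `A` (smooth projective of dimension
`dim A`), every `p` and every rational `(p,p)` class `c` on `A`, there are a compact pencil `f : 𝒳 ⟶ S`
CM-anchored for `(A, p, c)` (`Andre1996.IsCMAnchoredPencilFor A p c f`: relative dimension `2·dim A`, a CM
fibre, a fibre `𝒳_s ≅ A₁.X` with `g : A ⟶ A₁`, a fibrewise-Hodge global `W` with `g^*(W|_{𝒳_s}) = q·c`, `q ≠ 0`)
and β-Lefschetz for it. The Lefschetz-type analogue of (T∃); with `HC_CM` it gives `HC_AV` with NO named fact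
(`HC_AV_of_HC_CM_and_cmAnchoredPencilFibreClassLefschetz`); KIND 2 (its pencils carry no anchor but a CM fibre).
OPEN; a HYPOTHESIS wherever used. **ERRATUM: REFUTED-MISSTATED (unbounded `p` in `FibreClassLefschetzFor`; false given one rational Hodge class on one abelian variety, `not_fibreClassLefschetzFor`, part VIII); SUPERSEDED by `CMAnchoredPencilFibreClassLefschetzOn` (β∃′) of part VIII, whose fact-free row `HC_AV_of_HC_CM_and_cmAnchoredPencilFibreClassLefschetzOn` replaces the vacuous one below. Kept for the record.** [cite: Andre1996Motifs, Lemme 6.3.1 (p. 31)]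
[cite: Abdulali1994FamiliesAV, Conjecture 5.3 (p. 1130) and Lemma 6.2 (p. 1131)] -/
@[conjecture] def CMAnchoredPencilFibreClassLefschetz : Prop :=
  ∀ (A : AbelianVariety ℂ), IsSmoothProjective A.dim A.X →
    ∀ (p : ℕ) (c : complexBetti A.X (2 * p)), IsRationalClass c → IsOfHodgeType A.dim A.X (2 * p) p p c →
      ∃ (𝒳 S : SchemeOver ℂ) (f : 𝒳 ⟶ S) (hf : IsCMAnchoredPencilFor A p c f), FibreClassLefschetzFor hf.1

/-- (β∀) ⟹ (β). [folklore] -/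
theorem fibreClassLefschetzCMPointedPencils_of_compactPencils (h : FibreClassLefschetzCompactPencils) :
    FibreClassLefschetzCMPointedPencils :=
  fun _ _ _ _ hf _ ↦ h hf

/-- **(β) ∧ Lemme 6.3.1 ⟹ (β∃)**: the pencil of Lemme 6.3.1 has a CM fibre, at which (β) applies.
[cite: Andre1996Motifs, Lemme 6.3.1 (p. 31)] -/
theorem cmAnchoredPencilFibreClassLefschetz_of_andre1996_of_cmPointed (h₂₁ : andre1996_cmAnchoredPencil)
    (h : FibreClassLefschetzCMPointedPencils) : CMAnchoredPencilFibreClassLefschetz := by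
  intro A hA p c hc hpp
  obtain ⟨𝒳, S, f, hf⟩ := h₂₁ A hA p c hc hpp
  obtain ⟨-, -, t, -, -, A₀, -, -, -, -, -, -, ⟨e₀⟩, hA₀⟩ := id hf
  exact ⟨𝒳, S, f, hf, h hf.1 ⟨t, mem_cmLocus_of_compactPencil hf.1 e₀ hA₀⟩⟩

/-! ## §B Kernel edges, no named fact: β-Lefschetz ⟹ the lift nodes ⟹ transport -/

/-- **The engine of this part.** On a compact pencil satisfying β-Lefschetz, a global class `W` whose
restriction to ONE fibre `𝒳_{s₀}` is algebraic agrees on EVERY fibre with the global ALGEBRAIC class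
`η := T(j_{s₀*} j_{s₀}^* W)`: `j_{s₀*}` of an algebraic class is algebraic (`fiberGysin_mem_algebraicClasses`),
`T` preserves algebraic classes (`map_mem_algebraicClasses_of_isAlgebraicCorrespondence`), and `j_s^* η = j_s^* W`
is the defining identity of `T`. This is the last line of Milne's proof of Prop. 1 / Abdulali's Thm. 5.5,
`a H^{2r}(A_s)^π = a H⁰(S, R^{2r}f_*ℚ)`, with its ONE use of `B(𝒳)` displayed as the hypothesis.
[cite: Milne2020HodgeClassesAV, Prop. 1, proof (pp. 7–8)] [cite: Abdulali1994FamiliesAV, Theorem 5.5 (p. 1130)] -/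
theorem exists_algebraic_lift_of_fibreClassLefschetzFor {d : ℕ} {f : 𝒳 ⟶ S} (hf : IsCompactAbelianPencil f d)
    (hF : FibreClassLefschetzFor hf) {p : ℕ} (W : complexBetti 𝒳 (2 * p)) {s₀ : ComplexPoints S}
    (h₀ : complexBetti.map (fiberι f s₀) (2 * p) W ∈ algebraicClasses (fiberOver f s₀) p) :
    ∃ η ∈ algebraicClasses 𝒳 p, ∀ s : ComplexPoints S,
      complexBetti.map (fiberι f s) (2 * p) η = complexBetti.map (fiberι f s) (2 * p) W := by
  obtain ⟨T, hT, hTW⟩ := hF p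
  exact ⟨T (fiberGysin hf s₀ p (complexBetti.map (fiberι f s₀) (2 * p) W)),
    map_mem_algebraicClasses_of_isAlgebraicCorrespondence hf.isSmoothProjective_total hf.isSmoothProjective_total
      hT (fiberGysin_mem_algebraicClasses hf s₀ h₀),
    fun s ↦ hTW W s₀ s⟩

/-- On a compact pencil satisfying β-Lefschetz, Grothendieck's transport of algebraicity (Abdulali's (1.1),
`InvariantCyclesHoldFor`) holds — from ANY algebraic fibre to every fibre (the lift, then restriction of the
algebraic `η`; equivalently part I's engine `map_fiberι_mem_algebraicClasses_of_lift`).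
[cite: Abdulali1994FamiliesAV, (1.1) (p. 1122) and Theorem 5.5 (p. 1130)] -/
theorem invariantCyclesHoldFor_of_fibreClassLefschetzFor {d : ℕ} {f : 𝒳 ⟶ S} (hf : IsCompactAbelianPencil f d)
    (hF : FibreClassLefschetzFor hf) : InvariantCyclesHoldFor f d := by
  rintro p W - ⟨s₀, h₀⟩ s
  obtain ⟨η, hη, hηs⟩ := exists_algebraic_lift_of_fibreClassLefschetzFor hf hF W h₀
  exact map_fiberι_mem_algebraicClasses_of_lift hf hη (hηs s) s

/-- **(β∀) ⟹ (L∀)** (Abdulali's Thm. 5.5: Conjecture 5.3 gives the algebraic partie fixe at every `P`).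
[cite: Abdulali1994FamiliesAV, Theorem 5.5 (p. 1130)] -/
theorem algebraicFixedPart_of_fibreClassLefschetzCompactPencils (h : FibreClassLefschetzCompactPencils) :
    AlgebraicFixedPart := by
  intro d 𝒳 S f hf p W _ s₀ h₀
  obtain ⟨η, hη, hηs⟩ := exists_algebraic_lift_of_fibreClassLefschetzFor hf (h hf) W h₀
  exact ⟨η, hη, hηs s₀⟩

/-- **(β) ⟹ (L)** (the lift at CM fibres: a CM point makes the pencil CM-pointed, and (β) lifts there).
[cite: Abdulali1994FamiliesAV, Theorem 5.5 (p. 1130)] [cite: Andre1996Motifs, §5.1 (p. 25)] -/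
theorem cmFibreAlgebraicLift_of_fibreClassLefschetzCMPointedPencils (h : FibreClassLefschetzCMPointedPencils) :
    CMFibreAlgebraicLift := by
  intro d 𝒳 S f hf p W _ t ht h₀
  obtain ⟨η, hη, hηs⟩ := exists_algebraic_lift_of_fibreClassLefschetzFor hf (h hf ⟨t, ht⟩) W h₀
  exact ⟨η, hη, hηs t⟩

/-- **(β) ⟹ (3)** (transport on CM-pointed compact pencils, from any algebraic fibre).
[cite: Abdulali1994FamiliesAV, (1.1) and p. 1122] [cite: Milne2020HodgeClassesAV, Prop. 1 (p. 7)] -/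
theorem cmPointedPencilVHC_of_fibreClassLefschetzCMPointedPencils (h : FibreClassLefschetzCMPointedPencils) :
    CMPointedPencilVHC :=
  fun _ _ _ _ hf hcm ↦ invariantCyclesHoldFor_of_fibreClassLefschetzFor hf (h hf hcm)

/-- **(β∀) ⟹ (2)** (transport on every compact pencil — Milne's Thm. 4 on compact pencils with Prop. 1's use
of `B` replaced by (β)). [cite: Milne2020HodgeClassesAV, Thm. 4 and Prop. 1 (pp. 7–8)] -/
theorem compactAbelianPencilVHC_of_fibreClassLefschetzCompactPencils (h : FibreClassLefschetzCompactPencils) :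
    CompactAbelianPencilVHC :=
  fun _ _ _ _ hf ↦ invariantCyclesHoldFor_of_fibreClassLefschetzFor hf (h hf)

/-- **(β) ⟹ (4)** (through (L)). [cite: Andre1996Motifs, §6.3 a) (p. 33)] -/
theorem cmAnchoredTransport_of_fibreClassLefschetzCMPointedPencils (h : FibreClassLefschetzCMPointedPencils) :
    CMAnchoredTransport :=
  cmAnchoredTransport_of_cmFibreAlgebraicLift (cmFibreAlgebraicLift_of_fibreClassLefschetzCMPointedPencils h)

/-- **(β∃) ⟹ (T∃)**: on the CM-anchored pencil supplied by (β∃), β-Lefschetz transports algebraicity out of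
any (in particular any CM) fibre, in every degree. [cite: Andre1996Motifs, Lemme 6.3.1 (p. 31) and §6.3 a) (p. 33)] -/
theorem cmAnchoredPencilTransport_of_cmAnchoredPencilFibreClassLefschetz
    (h : CMAnchoredPencilFibreClassLefschetz) : CMAnchoredPencilTransport := by
  intro A hA p c hc hpp
  obtain ⟨𝒳, S, f, hf, hF⟩ := h A hA p c hc hpp
  exact ⟨𝒳, S, f, hf, fun p' W hW t _ h₀ s ↦
    invariantCyclesHoldFor_of_fibreClassLefschetzFor hf.1 hF p' W hW ⟨t, h₀⟩ s⟩

/-! ## §C The rows: `HC_CM ∧ (β) ⟹ HC_AV` with the Abdulali/Milne fact eliminated; KIND-1 witnesses; Frame -/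

/-- **The Lefschetz-flavoured deliverable of the sub-cell with `h₈` ELIMINATED: `HC_CM → (β) → HC_AV`, modulo
André's Lemme 6.3.1 (`h₂₁`) only.** Compare part III's `HC_AV_of_HC_CM_of_abdulali_of_lefschetzBCMPointedPencils
(h₂₁) (h₈) (hCM) (hB : (5))`: the input (5) = all of `B*(𝒳)` is replaced by the one operator (β), and the
transport step is a kernel theorem (§B) instead of the named fact `h₈`. `HC_CM` is used once, at the CM fibre of
the 6.3.1 pencil (inside part I's `HC_AV_of_HC_CM_and_cmFibreAlgebraicLift`). research route, not a corollary;
conditional on HC_CM plus one named minimal statement.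
[cite: Andre1996Motifs, Lemme 6.3.1 (p. 31) and §6.3 a) (p. 33)] [cite: Abdulali1994FamiliesAV, Conjecture 5.3, Theorem 5.5 and Lemma 6.2 (pp. 1130–1131)] -/
theorem HC_AV_of_HC_CM_and_fibreClassLefschetzCMPointedPencils (h₂₁ : andre1996_cmAnchoredPencil)
    (hCM : RankFourFaces.CMAbelianHodge) (hF : FibreClassLefschetzCMPointedPencils) :
    PadicSemiregularLift.HodgeAbelianVarieties :=
  HC_AV_of_HC_CM_and_cmFibreAlgebraicLift h₂₁ hCM (cmFibreAlgebraicLift_of_fibreClassLefschetzCMPointedPencils hF)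

/-- **`HC_CM ∧ (β∃) ⟹ HC_AV` — NO named fact** (through part II's fact-free row for (T∃)). research route,
not a corollary; conditional on HC_CM plus one named minimal statement.
[cite: Andre1996Motifs, §6.3 a) (p. 33)] [cite: Abdulali1994FamiliesAV, Lemma 6.2 (p. 1131)] -/
theorem HC_AV_of_HC_CM_and_cmAnchoredPencilFibreClassLefschetz (hCM : RankFourFaces.CMAbelianHodge)
    (hF : CMAnchoredPencilFibreClassLefschetz) : PadicSemiregularLift.HodgeAbelianVarieties :=
  HC_AV_of_HC_CM_and_cmAnchoredPencilTransport hCM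
    (cmAnchoredPencilTransport_of_cmAnchoredPencilFibreClassLefschetz hF)

/-- **KIND-1 witness for (β∀)**: granted Lemmes 6.3.2–6.3.3 (`h₂₂`), β-Lefschetz on ALL compact pencils
already yields `HC_CM` (through (L∀) ⟹ (2) and deform's `HC_CM_of_andre1996_of_compactAbelianPencilVHC`), so
next to (β∀) the hypothesis `HC_CM` is idle — exactly as for (5∀) and (L∀).
[cite: Andre1996Motifs, Lemmes 6.3.2–6.3.3 and Remarque 2 (pp. 32–33)] -/
theorem HC_CM_of_andre1996_of_fibreClassLefschetzCompactPencils
    (h₂₂ : andre1996_cmHodgeClasses_algebraicallyAnchoredPencils) (hF : FibreClassLefschetzCompactPencils) :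
    RankFourFaces.CMAbelianHodge :=
  HC_CM_of_andre1996_of_algebraicFixedPart h₂₂ (algebraicFixedPart_of_fibreClassLefschetzCompactPencils hF)

/-- **(β∀) ⟹ `HC_AV` with NO `HC_CM`**, modulo Lemmes 6.3.1–6.3.3 (André's Remarque 2 / Milne's Thm. 4 on
compact pencils, with `B` of the total spaces weakened to β-Lefschetz and the transport proved).
[cite: Andre1996Motifs, Remarque 2 (p. 33)] [cite: Milne2020HodgeClassesAV, Thm. 4 (p. 8)] -/
theorem HC_AV_of_andre1996_of_fibreClassLefschetzCompactPencils (h₂₁ : andre1996_cmAnchoredPencil)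
    (h₂₂ : andre1996_cmHodgeClasses_algebraicallyAnchoredPencils) (hF : FibreClassLefschetzCompactPencils) :
    PadicSemiregularLift.HodgeAbelianVarieties :=
  HC_AV_of_andre1996_of_compactAbelianPencilVHC h₂₁ h₂₂
    (compactAbelianPencilVHC_of_fibreClassLefschetzCompactPencils hF)

/-- (β) is a SUFFICIENT complement of `HC_CM` (`Frame.ClosesWithCM`), modulo Lemme 6.3.1. NOT claimed:
`OnPathAV` / `ExactWithCM` for (β) — `T` is a cycle on the non-abelian `𝒳 × 𝒳`.
[cite: Andre1996Motifs, Lemme 6.3.1 (p. 31)] -/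
theorem closesWithCM_fibreClassLefschetzCMPointedPencils_of_andre1996 (h₂₁ : andre1996_cmAnchoredPencil) :
    ClosesWithCM FibreClassLefschetzCMPointedPencils :=
  fun hCM hF ↦ HC_AV_of_HC_CM_and_fibreClassLefschetzCMPointedPencils h₂₁ hCM hF

/-- (β∃) is a sufficient complement of `HC_CM` with NO named fact. [cite: Andre1996Motifs, §6.3 a) (p. 33)] -/
theorem closesWithCM_cmAnchoredPencilFibreClassLefschetz : ClosesWithCM CMAnchoredPencilFibreClassLefschetz :=
  fun hCM hF ↦ HC_AV_of_HC_CM_and_cmAnchoredPencilFibreClassLefschetz hCM hF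

/-- (β∀) makes `HC_CM` IDLE (`Frame.CMIdle`), modulo Lemmes 6.3.1–6.3.3. [cite: Andre1996Motifs, Remarque 2 (p. 33)] -/
theorem cmIdle_fibreClassLefschetzCompactPencils_of_andre1996 (h₂₁ : andre1996_cmAnchoredPencil)
    (h₂₂ : andre1996_cmHodgeClasses_algebraicallyAnchoredPencils) : CMIdle FibreClassLefschetzCompactPencils :=
  fun hF ↦ HC_AV_of_andre1996_of_fibreClassLefschetzCompactPencils h₂₁ h₂₂ hF

/-- `CMToAbelian` (item stmt-16267, OPEN — nothing here closes it) from (β), modulo Lemme 6.3.1: a typed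
conditional TOWARD the item. [cite: Andre1996Motifs, Lemme 6.3.1 (p. 31)] -/
theorem cmToAbelian_of_andre1996_of_fibreClassLefschetzCMPointedPencils (h₂₁ : andre1996_cmAnchoredPencil)
    (hF : FibreClassLefschetzCMPointedPencils) : RankFourFaces.CMToAbelian :=
  cmToAbelian_of_closesWithCM (closesWithCM_fibreClassLefschetzCMPointedPencils_of_andre1996 h₂₁) hF

end Summit.HodgeConjecture.HodgeConjecture.Ring2.AbelianAll

end
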